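import Summits.HodgeConjecture.HodgeConjecture.Theorems.F0P6aStubE6   -- ★ p850357 twin (part C; parts A∕B = ★ `Theorems.F0P6aStubE6Sockets` p850299 ∕ ★ `Theorems.F0P6aStubE6Organ` p850327) of ED. 1 13e64693fde2261b (namespace KEPT ⇒ every FQN unchanged)
import HarnessLib

/-! # F0_P6a_StubE6 — ED. 2 = SHIM (rung-0 re-home; LEAD «M-72» (4) ∕ «M-78» CLASS III, «K3» sweep; dealer «L7» LA7-plan (g4→g5); hand A-p14 (g39) on desk F0P6a-plan (g5)'s plate 09:18:55Z, RE-HOME TABLE v1.3.1 row 22)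

The 22 declarations of ED. 1 (sha16 13e64693fde2261b, 727 l., sorry-free: `StubE6`, `Reads`, `RingActionReading`, `RosatiOver`, `KottwitzOver`,
`kottwitzOver_of_reading`, `exists_complexPoint_base_mem_connectedComponent`, `exists_flatPoint`, `exists_markedReading_of_reads`,
`exists_ringActionReading_of_reads`, `ReadsC`, `readsC_of_galois_of_reading`, `reads_clause_of_readsC_clause`, `exists_reads_of_readsC`, `stub_E6_of`,
`stub_E6_of_reading_rosati`, `stub_E6_of_readsC_rosati`, `rosatiOver_of_ringActionReading`, `stub_E6_of_readsC`, `stub_E6_of_sigmaAN_sigmaGAL`,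
`stub_E6_of_sigmaGAL`, head `stub_E6_of_line : StubE6`) now live, byte for byte and under the SAME namespace
`Summit.HodgeConjecture.HodgeConjecture.Cruxes.HLiu418.F0P6aStubE6`, in the ★ triple `Theorems/F0P6aStubE6Sockets.lean` (p850299, §Sockets–§SigmaK) +
`Theorems/F0P6aStubE6Organ.lean` (p850327, §Organ) + `Theorems/F0P6aStubE6.lean` (p850357, §SigmaR + head; each part imports the previous, part A imports
★ `Theorems.F0P6aSigmaGAL` p850253 and ★ `Theorems.F0P6aReadsCReadingOfJunction` p848496) — RE-HOME TABLE v1.3.1 row 22, no cut decl (nothing to alias).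
This module keeps its name so that its ONE importer (`rg` 09:30Z: `Lines/F0_P6a_PELWitnessE.lean` l. 4) and by-name readers resolve unchanged through the
import above; it declares nothing.  ORDER NOTE: written together with ∕ after the `F0_P6a_SigmaGAL` shim (row 21) and the `F0_P6a_PELWitnessEDefs` shim
(row 20) — ED. 1 reached `Lines.F0_P6a_PELWitnessEDefs` through `Lines.F0_P6a_SigmaGAL` while the ★ twin reaches `Theorems.F0P6aPELWitnessEDefs`, so the (D)
declarations must have ONE home when this import lands; its importer `F0_P6a_PELWitnessE` (row 24, LA5-p02 (g4)) is shimmed in the same request (chain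
SigmaGAL ← StubE6 ← PELWitnessE ← {PELInputs, StubKOTT}, serial inside the 33-cone, lake orders).  Edition history ED. 1 stays in the line card and in git;
future changes are ★-side proposals on the `Theorems/` files.  HC_CM is proved only modulo the 7 printed citations (2 remaining named inputs:
hLiu418 = stmt-HodgeConjecture-24832, h413 = stmt-HodgeConjecture-24833) until rung 0 closes; count-neutral (0 `sorry`, 0 socket, 0 declaration). -/
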